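import Summits.CriticalPhenomena.SAWScalingLimit.Theorems.SAWDefectDecoherenceBoundaryClosureRBoundaryBookkeepingPath
import HarnessLib

/-!
# The exact lattice arms of the developing map at a floor root

Route `SAWDefectDecoherence`, crux `BoundaryClosureR` (stmt-CriticalPhenomena-14004), line
`pick-half-plane`, wave 7, serving `stub_pickEngine` (lattice form of the arm conditions (I1) of
`pickEngine_stage2`): registered sub-goal `pickEngine_latticeArms`.  Setting: `Λ` simply connected, a
flat floor `k₁ ≤ k ≤ k₂` of row `mr` with the ROOT `a = floorEdge ka mr` on it, a NORMALISER floor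
dart `b = floorEdge kb m' ≠ a` reached by a walk `γ_b : a → b` (winding `W_b`), a potential `H`
(`IsPotential Λ a H`), `b`-frame increments `(H s − H s')/F_{5/8}(b)`, `Z(e) = ‖F_{x_c,0}(e)‖`.
Results: `F_{5/8}(b) = −e^{i(3/8)W_b} Z(b)`, `Z(b) > 0`, `e^{iW_b} = −1`; the steps of `H` along
the floor (`((2ζ−1)/6)·e^{∓i3π/8}·Z_k` east / west of the root by the rigid windings `∓π`, and
`−(2ζ−1)/6` across the root); in the `b`-frame the eastward step east of the root is
`e^{iθ}·(√3/6)·Z_k/Z_b` and the westward step west of the root `e^{i(θ−π/4)}·(√3/6)·Z_k/Z_b` with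
the EXPLICIT class-free angle **`θ = −(3/8)·W_b − 7π/8`**; the two ARMS are the rays of directions
`e^{iθ}` from `h(ka+1, mr) = 0` (partial sums `(√3/6)Σ Z/Z_b`) and `e^{i(θ−π/4)}` from `h(ka, mr)`;
the root step is `e^{i(π/2 − (3/8)W_b)}·(√3/6)/Z_b`; and the WEDGE ANGLE is
**`(−e^{i(5/8)W_b})·e^{−iθ} = −e^{−iπ/8}`**.
-/

noncomputable section

open Literature.Probability.LatticeModels Literature.Probability.RandomPlanarGeometry.SAW

namespace Summit.CriticalPhenomena.SAWScalingLimit.Theorems.PickHalfPlane.BoundaryExactness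

variable {Λ : Finset HexVertex}

/-- The arrival mass at a mid-edge reached by a walk is positive. [folklore] -/
theorem arrivalMass_pos {a z : Sym2 HexVertex} (γ : HexMidEdgeSAW Λ a z) :
    0 < ‖hexParafermionicObservable Λ a hexCriticalFugacity 0 z‖ := by
  have h0 := hexCriticalFugacity_pos_lt_one.1
  rw [hexParafermionicObservable_zero_spin, Complex.norm_real,
    Real.norm_of_nonneg (Finset.sum_nonneg fun γ' _ => pow_nonneg h0.le _)]
  exact lt_of_lt_of_le (pow_pos h0 γ.length)
    (Finset.single_le_sum (fun γ' _ => pow_nonneg h0.le _) (Finset.mem_univ γ))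

/-- **The dressed observable at a floor dart** `e = floorEdge k m ≠ a` reached by `γ` from the
floor root `a`: `F_{5/8}(e) = −e^{i(3/8)W(γ)}·Z(e)` (phase law (E2)). [folklore] -/
theorem floorDart_observable_eq (hΛ : hexDomainSimplyConnected Λ) {ka mr k m : ℤ}
    (hUa : upFace ka mr ∈ Λ) (hBa : belowFace ka mr ∉ Λ) (hU : upFace k m ∈ Λ)
    (hB : belowFace k m ∉ Λ) (hne : floorEdge k m ≠ floorEdge ka mr)
    (γ : HexMidEdgeSAW Λ (floorEdge ka mr) (floorEdge k m)) :
    hexParafermionicObservable Λ (floorEdge ka mr) hexCriticalFugacity (5 / 8) (floorEdge k m) =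
      -Complex.exp (Complex.I * (3 / 8 : ℂ) * (γ.winding : ℂ)) *
        (‖hexParafermionicObservable Λ (floorEdge ka mr) hexCriticalFugacity 0 (floorEdge k m)‖ : ℂ) := by
  have hE2 := boundaryExactness_phaseLaw Λ hΛ (belowFace ka mr) (upFace ka mr)
    (adj_belowFace_upFace ka mr) hBa hUa (belowFace k m) (upFace k m) (adj_belowFace_upFace k m)
    hB hU hne γ
  change (hexMidpoint (floorEdge k m) - hexCenter (upFace k m)) *
      hexParafermionicObservable Λ (floorEdge ka mr) hexCriticalFugacity (5 / 8) (floorEdge k m) =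
    (hexCenter (upFace ka mr) - hexCenter (belowFace ka mr)) / 2 *
      Complex.exp (Complex.I * (3 / 8 : ℂ) * (γ.winding : ℂ)) *
      (‖hexParafermionicObservable Λ (floorEdge ka mr) hexCriticalFugacity 0 (floorEdge k m)‖ : ℂ)
    at hE2
  rw [hexMidpoint_floorEdge_sub, hexCenter_upFace_sub_belowFace] at hE2
  have hv0 : ((2 * triZeta - 1) / 3 : ℂ) ≠ 0 := by
    intro h0
    have := congrArg Complex.im h0
    simp [triZeta_im] at this
  have h3 : ((2 * triZeta - 1) / 3) / 2 *
      (hexParafermionicObservable Λ (floorEdge ka mr) hexCriticalFugacity (5 / 8) (floorEdge k m) +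
        Complex.exp (Complex.I * (3 / 8 : ℂ) * (γ.winding : ℂ)) *
        (‖hexParafermionicObservable Λ (floorEdge ka mr) hexCriticalFugacity 0 (floorEdge k m)‖ : ℂ))
      = 0 := by
    have e : ((1 : ℂ) - 2 * triZeta) / 6 = -(((2 * triZeta - 1) / 3) / 2) := by ring
    rw [e] at hE2
    linear_combination (-1 : ℂ) * hE2
  rcases mul_eq_zero.1 h3 with h | h
  · exact absurd h (div_ne_zero hv0 two_ne_zero)
  · linear_combination h

/-- **`e^{iW} = −1` between two floor darts** (enter upwards, leave downwards). [folklore] -/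
theorem exp_winding_floorDarts {ka mr k m : ℤ} (hBa : belowFace ka mr ∉ Λ)
    (hB : belowFace k m ∉ Λ) (hne : floorEdge k m ≠ floorEdge ka mr)
    (γ : HexMidEdgeSAW Λ (floorEdge ka mr) (floorEdge k m)) :
    Complex.exp ((γ.winding : ℂ) * Complex.I) = -1 := by
  have hdir : Complex.exp ((γ.winding : ℂ) * Complex.I) *
      (hexCenter (upFace ka mr) - hexCenter (belowFace ka mr)) =
      hexCenter (belowFace k m) - hexCenter (upFace k m) :=
    exp_winding_mul_dir (adj_belowFace_upFace ka mr) hBa (adj_belowFace_upFace k m) hB hne γ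
  rw [hexCenter_upFace_sub_belowFace, show hexCenter (belowFace k m) - hexCenter (upFace k m) =
    -((2 * triZeta - 1) / 3) by rw [← hexCenter_upFace_sub_belowFace k m]; ring] at hdir
  have hv0 : ((2 * triZeta - 1) / 3 : ℂ) ≠ 0 := by
    intro h0
    have := congrArg Complex.im h0
    simp [triZeta_im] at this
  have h2 : (Complex.exp ((γ.winding : ℂ) * Complex.I) + 1) * ((2 * triZeta - 1) / 3) = 0 := by
    linear_combination hdir
  rcases mul_eq_zero.1 h2 with h | h
  · linear_combination h
  · exact absurd h hv0

/-- **Floor steps**: the EASTWARD step of a potential across the dual edge of `floorEdge k mr` is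
`((2ζ−1)/6)·e^{−i3π/8}·Z_k` east of the root (rigid winding `−π`) and `((2ζ−1)/6)·e^{+i3π/8}·Z_k`
west of it (winding `+π`). [folklore] -/
theorem floor_step_eq (hΛ : hexDomainSimplyConnected Λ) {mr k₁ k₂ ka : ℤ}
    (hF : ∀ k : ℤ, k₁ ≤ k → k ≤ k₂ → ((![k, mr], 0) : HexVertex) ∈ Λ ∧
      ((![k, mr - 1], 1) : HexVertex) ∉ Λ ∧ (k < k₂ → ((![k, mr], 1) : HexVertex) ∈ Λ))
    (hka₁ : k₁ ≤ ka) (hka₂ : ka ≤ k₂) {H : Site 2 → ℂ} (hH : IsPotential Λ (floorEdge ka mr) H)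
    {k : ℤ} (hk₁ : k₁ ≤ k) (hk₂ : k ≤ k₂) :
    (ka < k → H ![k + 1, mr] - H ![k, mr] = (2 * triZeta - 1) / 3 / 2 *
        Complex.exp (-(Complex.I * (3 / 8 : ℂ) * Real.pi)) *
        (‖hexParafermionicObservable Λ (floorEdge ka mr) hexCriticalFugacity 0 (floorEdge k mr)‖ : ℂ)) ∧
    (k < ka → H ![k + 1, mr] - H ![k, mr] = (2 * triZeta - 1) / 3 / 2 *
        Complex.exp (Complex.I * (3 / 8 : ℂ) * Real.pi) *
        (‖hexParafermionicObservable Λ (floorEdge ka mr) hexCriticalFugacity 0 (floorEdge k mr)‖ : ℂ)) := by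
  have ha := mk_mem_hexDomainBoundary (adj_belowFace_upFace ka mr) (hF ka hka₁ hka₂).2.1
    (hF ka hka₁ hka₂).1
  have hb := mk_mem_hexDomainBoundary (adj_belowFace_upFace k mr) (hF k hk₁ hk₂).2.1 (hF k hk₁ hk₂).1
  rw [potential_floor_step hH (hF k hk₁ hk₂).1, hexMidpoint_floorEdge_sub]
  -- along a walk, the dressed law; without walks both sides vanish
  have main : ∀ (hkne : k ≠ ka) (γ : HexMidEdgeSAW Λ (floorEdge ka mr) (floorEdge k mr)),
      ((1 : ℂ) - 2 * triZeta) / 6 *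
        hexParafermionicObservable Λ (floorEdge ka mr) hexCriticalFugacity (5 / 8) (floorEdge k mr) =
      (2 * triZeta - 1) / 3 / 2 * Complex.exp (Complex.I * (3 / 8 : ℂ) * (γ.winding : ℂ)) *
        (‖hexParafermionicObservable Λ (floorEdge ka mr) hexCriticalFugacity 0 (floorEdge k mr)‖ : ℂ) := by
    intro hkne γ
    rw [floorDart_observable_eq hΛ (hF ka hka₁ hka₂).1 (hF ka hka₁ hka₂).2.1 (hF k hk₁ hk₂).1
      (hF k hk₁ hk₂).2.1 (floorEdge_ne (m := mr) hkne) γ]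
    ring
  by_cases hne : Nonempty (HexMidEdgeSAW Λ (floorEdge ka mr) (floorEdge k mr))
  swap
  · rw [not_nonempty_iff] at hne
    have h0 : hexParafermionicObservable Λ (floorEdge ka mr) hexCriticalFugacity (5 / 8)
        (floorEdge k mr) = 0 ∧
        ‖hexParafermionicObservable Λ (floorEdge ka mr) hexCriticalFugacity 0 (floorEdge k mr)‖ = 0 := by
      simp [hexParafermionicObservable]
    rw [h0.1, h0.2]; simp
  obtain ⟨γ⟩ := hne
  have hw := fun W : HexMidEdgeSAW Λ (floorEdge ka mr) (floorEdge k mr) =>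
    boundaryWindingRigidity_proof Λ hΛ _ ha _ hb γ W
  constructor
  · intro hlt
    obtain ⟨⟨W, hW⟩, -⟩ := exists_floor_walks hF hka₁ hk₂ hlt
    have hw' : γ.winding = -Real.pi := (hw W).trans hW
    rw [main hlt.ne' γ, hw']
    push_cast
    ring_nf
  · intro hgt
    obtain ⟨-, W, hW⟩ := exists_floor_walks hF hk₁ hka₂ hgt
    have hw' : γ.winding = Real.pi := (hw W).trans hW
    rw [main hgt.ne γ, hw']

/-- **The root step**: across the dual edge of the root the potential changes by
`(mid_a − c_up)·F(a) = −(2ζ−1)/6` (`F(a) = 1`). [folklore] -/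
theorem root_step_eq {ka mr : ℤ} (hUa : upFace ka mr ∈ Λ) (hBa : belowFace ka mr ∉ Λ)
    {H : Site 2 → ℂ} (hH : IsPotential Λ (floorEdge ka mr) H) :
    H ![ka + 1, mr] - H ![ka, mr] = -((2 * triZeta - 1) / 3 / 2) := by
  rw [potential_floor_step hH hUa, hexParafermionicObservable_self
    (show floorEdge ka mr ∈ hexDomainBoundary Λ from
      mk_mem_hexDomainBoundary (adj_belowFace_upFace ka mr) hBa hUa), mul_one,
    hexMidpoint_floorEdge_sub]
  ring

/-! ### The `b`-frame: increments, arms, and the wedge angle -/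

/-- **The normaliser's observable**: `F_{5/8}(b) = −e^{i(3/8)W_b}·Z_b ≠ 0` with `Z_b > 0`.
[folklore] -/
theorem normaliser_observable (hΛ : hexDomainSimplyConnected Λ) {ka mr kb m' : ℤ}
    (hUa : upFace ka mr ∈ Λ) (hBa : belowFace ka mr ∉ Λ) (hUb : upFace kb m' ∈ Λ)
    (hBb : belowFace kb m' ∉ Λ) (hneb : floorEdge kb m' ≠ floorEdge ka mr)
    (γb : HexMidEdgeSAW Λ (floorEdge ka mr) (floorEdge kb m')) :
    hexParafermionicObservable Λ (floorEdge ka mr) hexCriticalFugacity (5 / 8) (floorEdge kb m') =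
      -Complex.exp (Complex.I * (3 / 8 : ℂ) * (γb.winding : ℂ)) *
        (‖hexParafermionicObservable Λ (floorEdge ka mr) hexCriticalFugacity 0 (floorEdge kb m')‖ : ℂ) ∧
    0 < ‖hexParafermionicObservable Λ (floorEdge ka mr) hexCriticalFugacity 0 (floorEdge kb m')‖ :=
  ⟨floorDart_observable_eq hΛ hUa hBa hUb hBb hneb γb, arrivalMass_pos γb⟩

/-- **The `b`-frame increments** (`θ = −(3/8)W_b − 7π/8`): eastward east of the root
`e^{iθ}·(√3/6)·Z_k/Z_b`, westward west of it `e^{i(θ−π/4)}·(√3/6)·Z_k/Z_b`, across the root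
`e^{i(π/2 − (3/8)W_b)}·(√3/6)/Z_b`. [folklore] -/
theorem frame_increments (hΛ : hexDomainSimplyConnected Λ) {mr k₁ k₂ ka : ℤ}
    (hF : ∀ k : ℤ, k₁ ≤ k → k ≤ k₂ → ((![k, mr], 0) : HexVertex) ∈ Λ ∧
      ((![k, mr - 1], 1) : HexVertex) ∉ Λ ∧ (k < k₂ → ((![k, mr], 1) : HexVertex) ∈ Λ))
    (hka₁ : k₁ ≤ ka) (hka₂ : ka ≤ k₂) {kb m' : ℤ} (hUb : upFace kb m' ∈ Λ) (hBb : belowFace kb m' ∉ Λ)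
    (hneb : floorEdge kb m' ≠ floorEdge ka mr) (γb : HexMidEdgeSAW Λ (floorEdge ka mr) (floorEdge kb m'))
    {H : Site 2 → ℂ} (hH : IsPotential Λ (floorEdge ka mr) H) :
    (∀ k : ℤ, ka < k → k ≤ k₂ → (H ![k + 1, mr] - H ![k, mr]) /
        hexParafermionicObservable Λ (floorEdge ka mr) hexCriticalFugacity (5 / 8) (floorEdge kb m') =
        Complex.exp (Complex.I * ((-(3 / 8 * γb.winding) - 7 / 8 * Real.pi : ℝ) : ℂ)) *
          ((Real.sqrt 3 / 6 *
            (‖hexParafermionicObservable Λ (floorEdge ka mr) hexCriticalFugacity 0 (floorEdge k mr)‖ /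
              ‖hexParafermionicObservable Λ (floorEdge ka mr) hexCriticalFugacity 0 (floorEdge kb m')‖) : ℝ) : ℂ)) ∧
    (∀ k : ℤ, k₁ ≤ k → k < ka → (H ![k, mr] - H ![k + 1, mr]) /
        hexParafermionicObservable Λ (floorEdge ka mr) hexCriticalFugacity (5 / 8) (floorEdge kb m') =
        Complex.exp (Complex.I * ((-(3 / 8 * γb.winding) - 7 / 8 * Real.pi - Real.pi / 4 : ℝ) : ℂ)) *
          ((Real.sqrt 3 / 6 *
            (‖hexParafermionicObservable Λ (floorEdge ka mr) hexCriticalFugacity 0 (floorEdge k mr)‖ /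
              ‖hexParafermionicObservable Λ (floorEdge ka mr) hexCriticalFugacity 0 (floorEdge kb m')‖) : ℝ) : ℂ)) ∧
    ((H ![ka + 1, mr] - H ![ka, mr]) /
        hexParafermionicObservable Λ (floorEdge ka mr) hexCriticalFugacity (5 / 8) (floorEdge kb m') =
      Complex.exp (Complex.I * ((Real.pi / 2 - 3 / 8 * γb.winding : ℝ) : ℂ)) *
        ((Real.sqrt 3 / 6 /
          ‖hexParafermionicObservable Λ (floorEdge ka mr) hexCriticalFugacity 0 (floorEdge kb m')‖ : ℝ) : ℂ)) := by
  obtain ⟨hFb, hZb⟩ := normaliser_observable hΛ (hF ka hka₁ hka₂).1 (hF ka hka₁ hka₂).2.1 hUb hBb hneb γb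
  set E1 := Complex.exp (Complex.I * (3 / 8 : ℂ) * (γb.winding : ℂ)) with hE1
  set Zb : ℝ := ‖hexParafermionicObservable Λ (floorEdge ka mr) hexCriticalFugacity 0 (floorEdge kb m')‖
    with hZbdef
  have hE10 : E1 ≠ 0 := Complex.exp_ne_zero _
  have hZb0 : (Zb : ℂ) ≠ 0 := Complex.ofReal_ne_zero.2 hZb.ne'
  have hinvE1 : E1⁻¹ = Complex.exp (-(Complex.I * (3 / 8 : ℂ) * (γb.winding : ℂ))) := by
    rw [hE1, Complex.exp_neg]
  -- `e^{iπ/2} = i`, `e^{−iπ/2} = −i`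
  have hI : Complex.exp (((Real.pi / 2 : ℝ) : ℂ) * Complex.I) = Complex.I := by
    rw [Complex.exp_mul_I, ← Complex.ofReal_cos, ← Complex.ofReal_sin, Real.cos_pi_div_two,
      Real.sin_pi_div_two]
    simp
  have hnegI : Complex.exp (-(((Real.pi / 2 : ℝ) : ℂ) * Complex.I)) = -Complex.I := by
    rw [Complex.exp_neg, hI, Complex.inv_I]
  refine ⟨fun k hk hk₂ => ?_, fun k hk₁ hk => ?_, ?_⟩
  · -- eastward, east of the root: `e^{iθ} = −i e^{−i3π/8} / E1`
    rw [(floor_step_eq hΛ hF hka₁ hka₂ hH (by omega) hk₂).1 hk, hFb, floorDir_eq]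
    have key : Complex.exp (Complex.I * ((-(3 / 8 * γb.winding) - 7 / 8 * Real.pi : ℝ) : ℂ)) =
        Complex.exp (-(((Real.pi / 2 : ℝ) : ℂ) * Complex.I)) *
          Complex.exp (-(Complex.I * (3 / 8 : ℂ) * Real.pi)) *
          Complex.exp (-(Complex.I * (3 / 8 : ℂ) * (γb.winding : ℂ))) := by
      rw [← Complex.exp_add, ← Complex.exp_add]
      congr 1
      push_cast
      ring
    rw [hnegI, ← hinvE1] at key
    rw [key]
    push_cast
    field_simp
  · -- westward, west of the root: `e^{i(θ−π/4)} = i e^{i3π/8} / E1`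
    rw [← neg_sub (H ![k + 1, mr]), (floor_step_eq hΛ hF hka₁ hka₂ hH hk₁ (by omega)).2 hk, hFb,
      floorDir_eq]
    have h32 : Complex.exp (-(((3 * Real.pi / 2 : ℝ) : ℂ) * Complex.I)) = Complex.I := by
      have e : -(((3 * Real.pi / 2 : ℝ) : ℂ) * Complex.I) =
          ((Real.pi / 2 : ℝ) : ℂ) * Complex.I + -(2 * Real.pi * Complex.I) := by push_cast; ring
      rw [e, Complex.exp_add, hI, Complex.exp_neg, Complex.exp_two_pi_mul_I]
      simp
    have key : Complex.exp (Complex.I *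
        ((-(3 / 8 * γb.winding) - 7 / 8 * Real.pi - Real.pi / 4 : ℝ) : ℂ)) =
        Complex.exp (-(((3 * Real.pi / 2 : ℝ) : ℂ) * Complex.I)) *
          Complex.exp (Complex.I * (3 / 8 : ℂ) * Real.pi) *
          Complex.exp (-(Complex.I * (3 / 8 : ℂ) * (γb.winding : ℂ))) := by
      rw [← Complex.exp_add, ← Complex.exp_add]
      congr 1
      push_cast
      ring
    rw [h32, ← hinvE1] at key
    rw [key]
    push_cast
    field_simp
  · -- the root step
    rw [root_step_eq (hF ka hka₁ hka₂).1 (hF ka hka₁ hka₂).2.1 hH, hFb, floorDir_eq]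
    have key : Complex.exp (Complex.I * ((Real.pi / 2 - 3 / 8 * γb.winding : ℝ) : ℂ)) =
        Complex.exp (((Real.pi / 2 : ℝ) : ℂ) * Complex.I) *
          Complex.exp (-(Complex.I * (3 / 8 : ℂ) * (γb.winding : ℂ))) := by
      rw [← Complex.exp_add]
      congr 1
      push_cast
      ring
    rw [hI, ← hinvE1] at key
    rw [key]
    push_cast
    field_simp

/-- **The lattice arms**: east `(H(ka+1+n,mr) − H(ka+1,mr))/F(b) = e^{iθ}·(√3/6)·Σ_{i<n} Z_{ka+1+i}/Z_b`,
west `(H(ka−n,mr) − H(ka,mr))/F(b) = e^{i(θ−π/4)}·(√3/6)·Σ_{i<n} Z_{ka−1−i}/Z_b`. [folklore] -/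
theorem lattice_arms (hΛ : hexDomainSimplyConnected Λ) {mr k₁ k₂ ka : ℤ}
    (hF : ∀ k : ℤ, k₁ ≤ k → k ≤ k₂ → ((![k, mr], 0) : HexVertex) ∈ Λ ∧
      ((![k, mr - 1], 1) : HexVertex) ∉ Λ ∧ (k < k₂ → ((![k, mr], 1) : HexVertex) ∈ Λ))
    (hka₁ : k₁ ≤ ka) (hka₂ : ka ≤ k₂) {kb m' : ℤ} (hUb : upFace kb m' ∈ Λ) (hBb : belowFace kb m' ∉ Λ)
    (hneb : floorEdge kb m' ≠ floorEdge ka mr) (γb : HexMidEdgeSAW Λ (floorEdge ka mr) (floorEdge kb m'))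
    {H : Site 2 → ℂ} (hH : IsPotential Λ (floorEdge ka mr) H) :
    (∀ n : ℕ, ka + 1 + n ≤ k₂ + 1 → (H ![ka + 1 + n, mr] - H ![ka + 1, mr]) /
        hexParafermionicObservable Λ (floorEdge ka mr) hexCriticalFugacity (5 / 8) (floorEdge kb m') =
        Complex.exp (Complex.I * ((-(3 / 8 * γb.winding) - 7 / 8 * Real.pi : ℝ) : ℂ)) *
          ((Real.sqrt 3 / 6 * ∑ i ∈ Finset.range n,
            ‖hexParafermionicObservable Λ (floorEdge ka mr) hexCriticalFugacity 0
                (floorEdge (ka + 1 + i) mr)‖ /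
              ‖hexParafermionicObservable Λ (floorEdge ka mr) hexCriticalFugacity 0 (floorEdge kb m')‖ : ℝ) : ℂ)) ∧
    (∀ n : ℕ, k₁ ≤ ka - n → (H ![ka - n, mr] - H ![ka, mr]) /
        hexParafermionicObservable Λ (floorEdge ka mr) hexCriticalFugacity (5 / 8) (floorEdge kb m') =
        Complex.exp (Complex.I * ((-(3 / 8 * γb.winding) - 7 / 8 * Real.pi - Real.pi / 4 : ℝ) : ℂ)) *
          ((Real.sqrt 3 / 6 * ∑ i ∈ Finset.range n,
            ‖hexParafermionicObservable Λ (floorEdge ka mr) hexCriticalFugacity 0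
                (floorEdge (ka - 1 - i) mr)‖ /
              ‖hexParafermionicObservable Λ (floorEdge ka mr) hexCriticalFugacity 0 (floorEdge kb m')‖ : ℝ) : ℂ)) := by
  obtain ⟨hE, hW, -⟩ := frame_increments hΛ hF hka₁ hka₂ hUb hBb hneb γb hH
  constructor
  · intro n
    induction n with
    | zero => intro _; simp
    | succ n ih =>
      intro hn
      have e : ka + 1 + ((n + 1 : ℕ) : ℤ) = ka + 1 + n + 1 := by push_cast; ring
      rw [e, show H ![ka + 1 + ↑n + 1, mr] - H ![ka + 1, mr] =
          (H ![ka + 1 + ↑n + 1, mr] - H ![ka + 1 + ↑n, mr]) + (H ![ka + 1 + ↑n, mr] - H ![ka + 1, mr]) by ring,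
        add_div, hE (ka + 1 + n) (by omega) (by push_cast at hn; omega), ih (by push_cast at hn; omega),
        Finset.sum_range_succ]
      push_cast
      ring
  · intro n
    induction n with
    | zero => intro _; simp
    | succ n ih =>
      intro hn
      have e : ka - ((n + 1 : ℕ) : ℤ) = ka - 1 - n := by push_cast; ring
      have e' : ka - 1 - (n : ℤ) + 1 = ka - n := by ring
      rw [e, show H ![ka - 1 - ↑n, mr] - H ![ka, mr] =
          (H ![ka - 1 - ↑n, mr] - H ![ka - 1 - ↑n + 1, mr]) + (H ![ka - 1 - ↑n + 1, mr] - H ![ka, mr]) by ring,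
        add_div, hW (ka - 1 - n) (by push_cast at hn; omega) (by omega), e', ih (by push_cast at hn; omega),
        Finset.sum_range_succ]
      push_cast
      ring

/-- **The wedge angle**: `(−e^{i(5/8)W_b})·e^{−iθ} = −e^{−iπ/8}` for `θ = −(3/8)W_b − 7π/8`
(`e^{iW_b} = −1`). [folklore] -/
theorem wedge_angle {ka mr kb m' : ℤ} (hBa : belowFace ka mr ∉ Λ) (hBb : belowFace kb m' ∉ Λ)
    (hneb : floorEdge kb m' ≠ floorEdge ka mr) (γb : HexMidEdgeSAW Λ (floorEdge ka mr) (floorEdge kb m')) :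
    -Complex.exp (Complex.I * (5 / 8 : ℂ) * (γb.winding : ℂ)) *
        (Complex.exp (Complex.I * ((-(3 / 8 * γb.winding) - 7 / 8 * Real.pi : ℝ) : ℂ)))⁻¹ =
      -Complex.exp (-(Complex.I * (Real.pi / 8))) := by
  have hW := exp_winding_floorDarts hBa hBb hneb γb
  rw [← Complex.exp_neg, neg_mul, ← Complex.exp_add]
  have e : Complex.I * (5 / 8 : ℂ) * (γb.winding : ℂ) +
      -(Complex.I * ((-(3 / 8 * γb.winding) - 7 / 8 * Real.pi : ℝ) : ℂ)) =
      (γb.winding : ℂ) * Complex.I + (Real.pi * Complex.I + -(Complex.I * (Real.pi / 8))) := by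
    push_cast; ring
  rw [e, Complex.exp_add, Complex.exp_add, hW, Complex.exp_pi_mul_I]
  ring

/-- **Registered sub-goal `pickEngine_latticeArms`** (crux stmt-CriticalPhenomena-14004, line
`pick-half-plane`, serving `stub_pickEngine`): the exact lattice arms at a floor root in the
`b`-frame, closed form, `θ = −(3/8)W_b − 7π/8`: (1) `F(b) = −e^{i(3/8)W_b} Z(b)`, `Z(b) > 0`;
(2) east arm `(H(ka+1+n,mr) − H(ka+1,mr))/F(b) = e^{iθ}·(√3/6)·Σ_{i<n} Z_{ka+1+i}/Z(b)`;
(3) west arm `(H(ka−n,mr) − H(ka,mr))/F(b) = e^{i(θ−π/4)}·(√3/6)·Σ_{i<n} Z_{ka−1−i}/Z(b)`;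
(4) root step `(H(ka+1,mr) − H(ka,mr))/F(b) = e^{i(π/2 − (3/8)W_b)}·(√3/6)/Z(b)`; (5) wedge angle
`(−e^{i(5/8)W_b})·e^{−iθ} = −e^{−iπ/8}`. [folklore] -/
theorem pickEngine_latticeArms :
    ∀ (Λ : Finset HexVertex), hexDomainSimplyConnected Λ →
    ∀ (mr k₁ k₂ ka : ℤ), (∀ k : ℤ, k₁ ≤ k → k ≤ k₂ → ((![k, mr], 0) : HexVertex) ∈ Λ ∧
        ((![k, mr - 1], 1) : HexVertex) ∉ Λ ∧ (k < k₂ → ((![k, mr], 1) : HexVertex) ∈ Λ)) →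
      k₁ ≤ ka → ka ≤ k₂ →
    ∀ (kb m' : ℤ), upFace kb m' ∈ Λ → belowFace kb m' ∉ Λ → floorEdge kb m' ≠ floorEdge ka mr →
    ∀ (γb : HexMidEdgeSAW Λ (floorEdge ka mr) (floorEdge kb m')) (H : Site 2 → ℂ),
      IsPotential Λ (floorEdge ka mr) H →
    (hexParafermionicObservable Λ (floorEdge ka mr) hexCriticalFugacity (5 / 8) (floorEdge kb m') =
      -Complex.exp (Complex.I * (3 / 8 : ℂ) * (γb.winding : ℂ)) *
        (‖hexParafermionicObservable Λ (floorEdge ka mr) hexCriticalFugacity 0 (floorEdge kb m')‖ : ℂ) ∧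
     0 < ‖hexParafermionicObservable Λ (floorEdge ka mr) hexCriticalFugacity 0 (floorEdge kb m')‖) ∧
    (∀ n : ℕ, ka + 1 + n ≤ k₂ + 1 → (H ![ka + 1 + n, mr] - H ![ka + 1, mr]) /
        hexParafermionicObservable Λ (floorEdge ka mr) hexCriticalFugacity (5 / 8) (floorEdge kb m') =
        Complex.exp (Complex.I * ((-(3 / 8 * γb.winding) - 7 / 8 * Real.pi : ℝ) : ℂ)) *
          ((Real.sqrt 3 / 6 * ∑ i ∈ Finset.range n,
            ‖hexParafermionicObservable Λ (floorEdge ka mr) hexCriticalFugacity 0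
                (floorEdge (ka + 1 + i) mr)‖ /
              ‖hexParafermionicObservable Λ (floorEdge ka mr) hexCriticalFugacity 0 (floorEdge kb m')‖ : ℝ) : ℂ)) ∧
    (∀ n : ℕ, k₁ ≤ ka - n → (H ![ka - n, mr] - H ![ka, mr]) /
        hexParafermionicObservable Λ (floorEdge ka mr) hexCriticalFugacity (5 / 8) (floorEdge kb m') =
        Complex.exp (Complex.I * ((-(3 / 8 * γb.winding) - 7 / 8 * Real.pi - Real.pi / 4 : ℝ) : ℂ)) *
          ((Real.sqrt 3 / 6 * ∑ i ∈ Finset.range n,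
            ‖hexParafermionicObservable Λ (floorEdge ka mr) hexCriticalFugacity 0
                (floorEdge (ka - 1 - i) mr)‖ /
              ‖hexParafermionicObservable Λ (floorEdge ka mr) hexCriticalFugacity 0 (floorEdge kb m')‖ : ℝ) : ℂ)) ∧
    ((H ![ka + 1, mr] - H ![ka, mr]) /
        hexParafermionicObservable Λ (floorEdge ka mr) hexCriticalFugacity (5 / 8) (floorEdge kb m') =
      Complex.exp (Complex.I * ((Real.pi / 2 - 3 / 8 * γb.winding : ℝ) : ℂ)) *
        ((Real.sqrt 3 / 6 /
          ‖hexParafermionicObservable Λ (floorEdge ka mr) hexCriticalFugacity 0 (floorEdge kb m')‖ : ℝ) : ℂ)) ∧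
    (-Complex.exp (Complex.I * (5 / 8 : ℂ) * (γb.winding : ℂ)) *
        (Complex.exp (Complex.I * ((-(3 / 8 * γb.winding) - 7 / 8 * Real.pi : ℝ) : ℂ)))⁻¹ =
      -Complex.exp (-(Complex.I * (Real.pi / 8)))) :=
  fun _ hΛ _ _ _ _ hF hka₁ hka₂ _ _ hUb hBb hneb γb _ hH =>
    ⟨normaliser_observable hΛ (hF _ hka₁ hka₂).1 (hF _ hka₁ hka₂).2.1 hUb hBb hneb γb,
      (lattice_arms hΛ hF hka₁ hka₂ hUb hBb hneb γb hH).1,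
      (lattice_arms hΛ hF hka₁ hka₂ hUb hBb hneb γb hH).2,
      (frame_increments hΛ hF hka₁ hka₂ hUb hBb hneb γb hH).2.2,
      wedge_angle (hF _ hka₁ hka₂).2.1 hBb hneb γb⟩

end Summit.CriticalPhenomena.SAWScalingLimit.Theorems.PickHalfPlane.BoundaryExactness
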